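import Summits.QuantumFields.YangMills.Theorems.LuscherReductionTraceDoorBasics
import Summits.QuantumFields.YangMills.Theorems.LuscherReductionTraceDoorInvAtoms
import Summits.QuantumFields.YangMills.Theorems.LuscherReductionRunningReductionLevelGapSummable
import HarnessLib

/-!
# `TraceDoorGlue` (stmt-QuantumFields-20206) landing — INV PREPARATION: continuity of `r_𝔥`, currency bridge, one-site limit, regularisation scale, extraction, summed discrepancy (skeleton PART 6 §6.2)

Route `LuscherReduction` (owner ym-beyond-p1), RED `RunningReduction` (stmt-QuantumFields-19978) split (route rev 11/12) along the TT door of the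
registered skeleton «KTR» rev 8 (`pub/ym-beyond/p1-g19-files/Lines-KTR-r8.lean`, sha16 4d4e029b06d8e70b); glue item `TraceDoorGlue`
(stmt-QuantumFields-20206) = `TraceFormula → TwistedTraceScaling → OneSiteTail → DressedRitz → RunningReduction`, landed under `Theorems/` as the
file family `LuscherReductionTraceDoor{Defs,Enclosure,Basics,InvAtoms,KT,InvPrep,OST,Glue}.lean` (namespace `…Theorems.FemtoTransferGap.TraceDoor`),
skeleton parts re-homed VERBATIM with the four children taken as the ROUTE DECLS (hypotheses), the skeleton's `Prop` currencies
(`CoarseNoIntruder`, `OneSiteLowerCoarse`, `CoarseLevels`, `OneSiteTraceLimit`) spelled out as texts, the door / Ritz basics / `LevelGapSummable` / ONE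
taken from the tree (`KTDoorR3.katoTempleDoorR3`, `KTDoorR3.ritzBasicsR3`, `LGS.levelGapSummable_all`, `oneSiteLevels_proof`).

THIS FILE (skeleton PART 6 «INV» §6.2, lattice half, VERBATIM): continuity of `s ↦ Σ e^{−sΔ_k}` and of Lüscher's ratio `r_𝔥` along sequences
(`LevelGapSummable` = tree `LGS.levelGapSummable_all`, dominated convergence); the CURRENCY BRIDGE under the route child `TraceFormula`
(`hasSum_xval_pow`, `levelMoment_eq`, `traceRatio_eq_levelRatio`); the one-site limit at a grid point from the `OneSiteTraceLimit` text;
the regularisation scale `exists_delta` (`Σ_j min(x_j², Sδj) + Σ_{j≥1} e^{−σ_min j/δ} ≤ ε` for small `δ`); the EXTRACTION of a violating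
sequence of windows along which the route child `TwistedTraceScaling` holds diagonally on the dyadic grid (`extract`); and the SUMMED
DISCREPANCY `|Σ_j e^{−σã_j} − m(T)| ≤ …` (`abs_tsum_exp_atomReg_sub_levelMoment_le`).

HONEST FRAMING: femto rung R2b1 (`FemtoGapOfRecord`) bookkeeping — the XL content (`TwistedTraceScaling`, `DressedRitz`) is ASSUMED, not proved;
nothing here bears on infinite volume, the continuum limit or the Clay mass gap.  Sorry-free, no new definitions.
-/

set_option autoImplicit false

noncomputable section

open MeasureTheory Filter Topology Real
open Literature.MathematicalPhysics.QuantumFieldTheory hiding SU2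
open Literature.MathematicalPhysics.QuantumLattice
open Literature.Analysis.OperatorTheory.YMMatrixModel
open scoped BigOperators

namespace Summit.QuantumFields.YangMills.Theorems.FemtoTransferGap.TraceDoor

open Summit.QuantumFields.YangMills.Theorems.FemtoTransferGap
open Summit.QuantumFields.YangMills.Theorems.FemtoTransferGap.TT (physTrace)

/-- **Continuity of `s ↦ Σ_k e^{−sΔ_k}` along sequences** (from `LevelGapSummable`, dominated convergence at `s/2`). -/
theorem tendsto_tsum_exp_levelGap {s : ℝ} (hs : 0 < s) {σ : ℕ → ℝ} (hσ : Tendsto σ atTop (𝓝 s)) :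
    Tendsto (fun n => ∑' k, Real.exp (-σ n * levelGap k)) atTop (𝓝 (∑' k, Real.exp (-s * levelGap k))) := by
  refine tendsto_tsum_of_dominated_convergence (bound := fun k => Real.exp (-(s / 2) * levelGap k))
    (Summit.QuantumFields.YangMills.Theorems.FemtoTransferGap.LGS.levelGapSummable_all (s / 2) (half_pos hs)) ?_ ?_
  · intro k
    exact (Real.continuous_exp.tendsto _).comp (hσ.neg.mul_const (levelGap k))
  · have hev : ∀ᶠ n in atTop, s / 2 ≤ σ n := hσ.eventually (eventually_ge_nhds (by linarith : s / 2 < s))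
    filter_upwards [hev] with n hn k
    rw [Real.norm_eq_abs, abs_of_pos (Real.exp_pos _)]
    exact Real.exp_le_exp.mpr (by nlinarith [levelGap_nonneg k])

/-- `Σ_k e^{−sΔ_k} ≥ e^0 > 0`. -/
theorem tsum_exp_levelGap_pos {s : ℝ} (hs : 0 < s) : 0 < ∑' k, Real.exp (-s * levelGap k) := by
  have h := (Summit.QuantumFields.YangMills.Theorems.FemtoTransferGap.LGS.levelGapSummable_all s hs).le_tsum 0 (fun j _ => (Real.exp_pos _).le)
  rw [levelGap_zero, mul_zero, Real.exp_zero] at h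
  linarith

/-- **Continuity of Lüscher's limiting ratio `r_𝔥`** along sequences. -/
theorem tendsto_hTraceRatio {s : ℝ} (hs : 0 < s) {σ : ℕ → ℝ} (hσ : Tendsto σ atTop (𝓝 s)) :
    Tendsto (fun n => hTraceRatio (σ n)) atTop (𝓝 (hTraceRatio s)) := by
  unfold hTraceRatio seqRatio
  have h2 : Tendsto (fun n => 2 * σ n) atTop (𝓝 (2 * s)) := hσ.const_mul 2
  have hnum := tendsto_tsum_exp_levelGap (by linarith : 0 < 2 * s) h2
  have hden := tendsto_tsum_exp_levelGap hs hσ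
  exact hnum.div (hden.pow 2) (pow_ne_zero 2 (tsum_exp_levelGap_pos hs).ne')

/-- **Currency bridge**: under `TraceFormula`, the level moments are the normalised traces and `traceRatio = levelRatio` (`β ≥ 1`, `T ≥ 2`). -/
theorem hasSum_xval_pow (hTF : Summit.QuantumFields.YangMills.Theses.LuscherReduction.TraceFormula) {L : ℕ} [NeZero L] {β : ℝ} (hβ : 1 ≤ β) {T : ℕ} (hT : 2 ≤ T) :
    HasSum (fun j => xval L β j ^ T) (physTrace L β T / levelValue su2Rep L β 0 ^ T) := by
  have h := (hTF L β T hβ hT).div_const (levelValue su2Rep L β 0 ^ T)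
  refine h.congr_fun ?_
  intro j
  unfold xval; rw [div_pow]

/-- Under `TraceFormula`: `m(L,β,T) = Z_phys(T)/λ_0^T` (`β ≥ 1`, `T ≥ 2`). -/
theorem levelMoment_eq (hTF : Summit.QuantumFields.YangMills.Theses.LuscherReduction.TraceFormula) {L : ℕ} [NeZero L] {β : ℝ} (hβ : 1 ≤ β) {T : ℕ} (hT : 2 ≤ T) :
    levelMoment L β T = physTrace L β T / levelValue su2Rep L β 0 ^ T := by
  unfold levelMoment
  exact (hasSum_xval_pow hTF hβ hT).tsum_eq

/-- Under `TraceFormula`: `traceRatio = levelRatio` (`β ≥ 1`, `T ≥ 2`). -/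
theorem traceRatio_eq_levelRatio (hTF : Summit.QuantumFields.YangMills.Theses.LuscherReduction.TraceFormula) {L : ℕ} [NeZero L] {β : ℝ} (hβ : 1 ≤ β) {T : ℕ} (hT : 2 ≤ T) :
    traceRatio L β T = levelRatio L β T := by
  have h0 := levelValue_zero_su2Rep_pos L β
  unfold traceRatio levelRatio
  rw [levelMoment_eq hTF hβ (by omega : 2 ≤ 2 * T), levelMoment_eq hTF hβ hT]
  have hp : levelValue su2Rep L β 0 ^ (2 * T) = (levelValue su2Rep L β 0 ^ T) ^ 2 := by rw [pow_mul']
  rw [hp, div_pow]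
  have hne : (levelValue su2Rep L β 0 ^ T) ^ 2 ≠ 0 := by positivity
  field_simp

/-- **One-site convergence at a grid point** (from `OneSiteTraceLimit`). -/
theorem tendsto_levelRatio_oneSite (hOS : (∀ s : ℝ, 0 < s → ∀ ε : ℝ, 0 < ε → ∃ B0 : ℝ, ∀ B : ℝ, B0 ≤ B → ∀ T : ℕ,
      |(T : ℝ) * bareLambda B - s| ≤ bareLambda B → |levelRatio 1 B T - hTraceRatio s| ≤ ε)) {s : ℝ} (hs : 0 < s) {B : ℕ → ℝ} {T : ℕ → ℕ}
    (hB : Tendsto B atTop atTop) (hT : ∀ n, |(T n : ℝ) * bareLambda (B n) - s| ≤ bareLambda (B n)) :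
    Tendsto (fun n => levelRatio 1 (B n) (T n)) atTop (𝓝 (hTraceRatio s)) := by
  rw [Metric.tendsto_atTop]
  intro ε hε
  obtain ⟨B0, hB0⟩ := hOS s hs (ε / 2) (half_pos hε)
  obtain ⟨N, hN⟩ := (Filter.tendsto_atTop.mp hB) B0 |>.exists_forall_of_atTop
  exact ⟨N, fun n hn => by
    rw [Real.dist_eq]
    exact lt_of_le_of_lt (hB0 (B n) (hN n hn) (T n) (hT n)) (half_lt_self hε)⟩

/-- **Smallness of the regularisation error** at a fixed lattice: for `Σ x_j² < ∞`, `σ_min > 0`, `S > 0` and `ε > 0` there is `δ ∈ (0,1]` with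
`Σ_j min(x_j², Sδ j) + Σ_{j ≥ 1} e^{−σ_min j/δ} ≤ ε`. -/
theorem exists_delta {x : ℕ → ℝ} (_hx0 : ∀ j, 0 ≤ x j) (hx : Summable fun j => x j ^ 2) {σmin S ε : ℝ}
    (hσ : 0 < σmin) (hS : 0 < S) (hε : 0 < ε) :
    ∃ δ : ℝ, 0 < δ ∧ δ ≤ 1 ∧ δ ≤ ε ∧
      (Summable fun j : ℕ => min (x j ^ 2) (S * δ * j)) ∧
      (Summable fun j : ℕ => if j = 0 then (0 : ℝ) else Real.exp (-σmin * ((j : ℝ) / δ))) ∧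
      (∑' j : ℕ, min (x j ^ 2) (S * δ * j)) + (∑' j : ℕ, if j = 0 then (0 : ℝ) else Real.exp (-σmin * ((j : ℝ) / δ))) ≤ ε := by
  -- (i) the truncation term: dominated convergence as δ → 0⁺
  set F : ℝ → ℝ := fun δ => ∑' j : ℕ, min (x j ^ 2) (S * δ * j) with hF
  have hFlim : Tendsto F (𝓝[>] 0) (𝓝 0) := by
    have key : Tendsto (fun δ : ℝ => ∑' j : ℕ, min (x j ^ 2) (S * δ * j)) (𝓝[>] 0) (𝓝 (∑' j : ℕ, (0 : ℝ))) := by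
      refine tendsto_tsum_of_dominated_convergence (bound := fun j => x j ^ 2) hx ?_ ?_
      · intro j
        have hc : Continuous fun δ : ℝ => min (x j ^ 2) (S * δ * j) := by fun_prop
        have := hc.tendsto 0
        simp only [mul_zero, zero_mul] at this
        rw [min_eq_right (sq_nonneg (x j))] at this
        exact tendsto_nhdsWithin_of_tendsto_nhds this
      · filter_upwards [self_mem_nhdsWithin] with δ (hδ : 0 < δ) j
        rw [Real.norm_eq_abs, abs_of_nonneg (le_min (sq_nonneg _) (by positivity))]
        exact min_le_left _ _
    simpa using key
  -- (ii) the zero-level term: a geometric series `r/(1-r)`, `r = e^{-σmin/δ} ≤ δ/σmin`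
  have hG : ∀ δ : ℝ, 0 < δ → HasSum (fun j : ℕ => if j = 0 then (0 : ℝ) else Real.exp (-σmin * ((j : ℝ) / δ)))
      (1 / (1 - Real.exp (-σmin / δ)) - 1) := by
    intro δ hδ
    set r := Real.exp (-σmin / δ) with hr
    have hr0 : 0 ≤ r := (Real.exp_pos _).le
    have hr1 : r < 1 := Real.exp_lt_one_iff.mpr (by rw [neg_div]; exact neg_neg_of_pos (div_pos hσ hδ))
    have h1 : HasSum (fun j : ℕ => r ^ j) (1 / (1 - r)) := by
      rw [one_div]; exact hasSum_geometric_of_lt_one hr0 hr1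
    have h2 : HasSum (fun j : ℕ => if j = 0 then (1 : ℝ) else 0) 1 := hasSum_ite_eq 0 1
    have hfun : (fun j : ℕ => if j = 0 then (0 : ℝ) else Real.exp (-σmin * ((j : ℝ) / δ))) =
        fun j : ℕ => r ^ j - (if j = 0 then (1 : ℝ) else 0) := by
      funext j
      split_ifs with hj
      · subst hj; simp
      · rw [sub_zero, hr, ← Real.exp_nat_mul]; congr 1; field_simp
    rw [hfun]
    exact h1.sub h2
  have hGbound : ∀ δ : ℝ, 0 < δ → δ ≤ σmin / 2 →
      (∑' j : ℕ, if j = 0 then (0 : ℝ) else Real.exp (-σmin * ((j : ℝ) / δ))) ≤ 2 * (δ / σmin) := by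
    intro δ hδ hδσ
    rw [(hG δ hδ).tsum_eq]
    set r := Real.exp (-σmin / δ) with hr
    have hy : 0 < σmin / δ := div_pos hσ hδ
    have hrle : r ≤ δ / σmin := by
      -- e^{-y} ≤ 1/y for y > 0
      have h1 : σmin / δ * Real.exp (-(σmin / δ)) ≤ 1 := by
        have := Real.add_one_le_exp (σmin / δ)
        have hpos := Real.exp_pos (-(σmin / δ))
        have hmul : Real.exp (σmin / δ) * Real.exp (-(σmin / δ)) = 1 := by rw [← Real.exp_add]; simp
        nlinarith
      rw [hr, neg_div]
      rw [le_div_iff₀ hσ]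
      have : σmin / δ * Real.exp (-(σmin / δ)) * δ ≤ 1 * δ := by gcongr
      calc Real.exp (-(σmin / δ)) * σmin = σmin / δ * Real.exp (-(σmin / δ)) * δ := by field_simp
        _ ≤ 1 * δ := this
        _ = δ := one_mul δ
    have hr2 : r ≤ 1 / 2 := hrle.trans (by rw [div_le_iff₀ hσ]; linarith)
    have hr0 : 0 ≤ r := (Real.exp_pos _).le
    rw [div_sub_one (by linarith : (1 - r) ≠ 0), show (1 - (1 - r)) = r by ring, div_le_iff₀ (by linarith : 0 < 1 - r)]
    nlinarith
  -- (iii) choose δ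
  have hev1 : ∀ᶠ δ in 𝓝[>] (0 : ℝ), F δ < ε / 2 := hFlim (Iio_mem_nhds (half_pos hε))
  have hev2 : ∀ᶠ δ in 𝓝[>] (0 : ℝ), δ < min (min 1 ε) (min (σmin / 2) (ε * σmin / 4)) :=
    nhdsWithin_le_nhds (Iio_mem_nhds (by positivity))
  obtain ⟨δ, hδF, hδlt, hδpos⟩ := (hev1.and (hev2.and self_mem_nhdsWithin)).exists
  have hδ1 : δ ≤ 1 := hδlt.le.trans ((min_le_left _ _).trans (min_le_left _ _))
  have hδe : δ ≤ ε := hδlt.le.trans ((min_le_left _ _).trans (min_le_right _ _))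
  have hδσ : δ ≤ σmin / 2 := hδlt.le.trans ((min_le_right _ _).trans (min_le_left _ _))
  have hδε : δ ≤ ε * σmin / 4 := hδlt.le.trans ((min_le_right _ _).trans (min_le_right _ _))
  have hδpos' : 0 < δ := hδpos
  refine ⟨δ, hδpos', hδ1, hδe, ?_, (hG δ hδpos').summable, ?_⟩
  · exact Summable.of_nonneg_of_le (fun j => le_min (sq_nonneg _) (by positivity)) (fun j => min_le_left _ _) hx
  · have hGδ := hGbound δ hδpos' hδσ
    have : 2 * (δ / σmin) ≤ ε / 2 := by
      rw [mul_div_assoc', div_le_iff₀ hσ]; linarith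
    have hFδ : F δ < ε / 2 := hδF
    simp only [hF] at hFδ
    linarith

/-- **Extraction** of a violating sequence along which `TwistedTraceScaling` holds diagonally on the grid (lattice sizes written `L n + 1`). -/
theorem extract (hTS : Summit.QuantumFields.YangMills.Theses.LuscherReduction.TwistedTraceScaling) {k : ℕ} {η : ℝ}
    (hviol : ¬ (∃ lam0 : ℝ, 0 < lam0 ∧ ∀ lam : ℝ, 0 < lam → lam ≤ lam0 →
      ∃ L0 : ℕ, ∀ (L : ℕ) [NeZero L], L0 ≤ L → ∀ β : ℝ, InFemtoWindow lam β L →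
        Real.exp (-((levelGap k + η) * luscherLambda β L) / L) * levelValue su2Rep L β 0 ≤ levelValue su2Rep L β k ∧
          levelValue su2Rep L β k ≤ Real.exp (-((levelGap k - η) * luscherLambda β L) / L) * levelValue su2Rep L β 0)) :
    ∃ (lam : ℕ → ℝ) (L : ℕ → ℕ) (β : ℕ → ℝ), ∀ n : ℕ,
      0 < lam n ∧ lam n ≤ 1 / ((n : ℝ) + 1) ∧ n ≤ L n ∧ InFemtoWindow (lam n) (β n) (L n + 1) ∧
      ¬ (Real.exp (-((levelGap k + η) * luscherLambda (β n) (L n + 1)) / (L n + 1 : ℕ)) * levelValue su2Rep (L n + 1) (β n) 0 ≤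
            levelValue su2Rep (L n + 1) (β n) k ∧
          levelValue su2Rep (L n + 1) (β n) k ≤
            Real.exp (-((levelGap k - η) * luscherLambda (β n) (L n + 1)) / (L n + 1 : ℕ)) * levelValue su2Rep (L n + 1) (β n) 0) ∧
      ∀ i ≤ n, |traceRatio (L n + 1) (β n) (femtoSteps (qgrid i) (β n) (L n + 1)) -
          traceRatio 1 (oneSiteCoupling (β n) (L n + 1)) (femtoSteps (qgrid i) (β n) (L n + 1))| ≤ 1 / ((n : ℝ) + 1) := by
  classical
  have main : ∀ n : ℕ, ∃ (lam : ℝ) (L : ℕ) (β : ℝ),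
      0 < lam ∧ lam ≤ 1 / ((n : ℝ) + 1) ∧ n ≤ L ∧ InFemtoWindow lam β (L + 1) ∧
      ¬ (Real.exp (-((levelGap k + η) * luscherLambda β (L + 1)) / (L + 1 : ℕ)) * levelValue su2Rep (L + 1) β 0 ≤
            levelValue su2Rep (L + 1) β k ∧
          levelValue su2Rep (L + 1) β k ≤
            Real.exp (-((levelGap k - η) * luscherLambda β (L + 1)) / (L + 1 : ℕ)) * levelValue su2Rep (L + 1) β 0) ∧
      ∀ i ≤ n, |traceRatio (L + 1) β (femtoSteps (qgrid i) β (L + 1)) -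
          traceRatio 1 (oneSiteCoupling β (L + 1)) (femtoSteps (qgrid i) β (L + 1))| ≤ 1 / ((n : ℝ) + 1) := by
    intro n
    have hε : (0 : ℝ) < 1 / ((n : ℝ) + 1) := by positivity
    have hT : ∀ i : ℕ, ∃ lam0 : ℝ, 0 < lam0 ∧ ∀ lam : ℝ, 0 < lam → lam ≤ lam0 → ∃ L0 : ℕ, ∀ (L : ℕ) [NeZero L], L0 ≤ L →
        ∀ β : ℝ, InFemtoWindow lam β L → |traceRatio L β (femtoSteps (qgrid i) β L) -
          traceRatio 1 (oneSiteCoupling β L) (femtoSteps (qgrid i) β L)| ≤ 1 / ((n : ℝ) + 1) :=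
      fun i => (twistedTraceScaling_iff.mp hTS) (qgrid i) (qgrid_pos i) _ hε
    choose lam0 hlam0 hT' using hT
    set lamStar : ℝ := min (1 / ((n : ℝ) + 1)) ((Finset.range (n + 1)).inf' ⟨0, by simp⟩ lam0) with hlamStar
    have hlamStar_pos : 0 < lamStar := lt_min hε ((Finset.lt_inf'_iff _).mpr fun i _ => hlam0 i)
    have hlamStar_le : ∀ i ≤ n, lamStar ≤ lam0 i := fun i hi =>
      (min_le_right _ _).trans (Finset.inf'_le _ (Finset.mem_range.mpr (Nat.lt_succ_of_le hi)))
    -- the violation, with the lattice size written as a successor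
    have hv : ∃ lam : ℝ, 0 < lam ∧ lam ≤ lamStar ∧ ∀ L0 : ℕ, ∃ L' : ℕ, L0 ≤ L' + 1 ∧ ∃ β : ℝ, InFemtoWindow lam β (L' + 1) ∧
        ¬ (Real.exp (-((levelGap k + η) * luscherLambda β (L' + 1)) / (L' + 1 : ℕ)) * levelValue su2Rep (L' + 1) β 0 ≤
              levelValue su2Rep (L' + 1) β k ∧
            levelValue su2Rep (L' + 1) β k ≤
              Real.exp (-((levelGap k - η) * luscherLambda β (L' + 1)) / (L' + 1 : ℕ)) * levelValue su2Rep (L' + 1) β 0) := by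
      by_contra hcon
      apply hviol
      refine ⟨lamStar, hlamStar_pos, fun lam hl hle => ?_⟩
      by_contra hno
      apply hcon
      refine ⟨lam, hl, hle, fun L0 => ?_⟩
      by_contra hno2
      apply hno
      refine ⟨L0, ?_⟩
      intro L inst hL β hW
      by_contra hP
      cases L with
      | zero => exact absurd rfl (NeZero.ne 0)
      | succ L' => exact hno2 ⟨L', hL, β, hW, hP⟩
    obtain ⟨lam, hl, hle, hv'⟩ := hv
    have hL0 : ∀ i : ℕ, ∃ L0 : ℕ, i ≤ n → ∀ (L : ℕ) [NeZero L], L0 ≤ L → ∀ β : ℝ, InFemtoWindow lam β L →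
        |traceRatio L β (femtoSteps (qgrid i) β L) - traceRatio 1 (oneSiteCoupling β L) (femtoSteps (qgrid i) β L)| ≤
          1 / ((n : ℝ) + 1) := by
      intro i
      by_cases hi : i ≤ n
      · obtain ⟨L0, h⟩ := hT' i lam hl (hle.trans (hlamStar_le i hi))
        exact ⟨L0, fun _ => h⟩
      · exact ⟨0, fun h => absurd h hi⟩
    choose L0 hL0' using hL0
    obtain ⟨L', hLge, β, hW, hP⟩ := hv' (max (n + 1) ((Finset.range (n + 1)).sup L0))
    have h1 : n + 1 ≤ L' + 1 := (le_max_left _ _).trans hLge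
    refine ⟨lam, L', β, hl, hle.trans (min_le_left _ _), by omega, hW, hP, fun i hi => ?_⟩
    have hi' : L0 i ≤ L' + 1 :=
      (Finset.le_sup (f := L0) (Finset.mem_range.mpr (Nat.lt_succ_of_le hi))).trans ((le_max_right _ _).trans hLge)
    exact hL0' i hi (L' + 1) hi' β hW
  choose lam L β h using main
  exact ⟨lam, L, β, h⟩

/-- **Summed discrepancy** at a fixed lattice: for `T ≥ 2`, `σ = T/c ∈ [σ_min, S]`,
`|Σ_j e^{−σ ã_j} − m(T)| ≤ Σ_j min(x_j², Sδ j) + Σ_{j ≥ 1} e^{−σ_min j/δ}`. -/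
theorem abs_tsum_exp_atomReg_sub_levelMoment_le (hTF : Summit.QuantumFields.YangMills.Theses.LuscherReduction.TraceFormula) {L : ℕ} [NeZero L] {β : ℝ} (hβ : 1 ≤ β)
    {c δ : ℝ} (hc : 0 < c) (hδ : 0 < δ) (hδ1 : δ ≤ 1) {T : ℕ} (hT : 2 ≤ T) {σmin S : ℝ} (hσmin : 0 < σmin)
    (hlow : σmin ≤ (T : ℝ) / c) (hup : (T : ℝ) / c ≤ S)
    (hs1 : Summable fun j : ℕ => min (xval L β j ^ 2) (S * δ * j))
    (hs2 : Summable fun j : ℕ => if j = 0 then (0 : ℝ) else Real.exp (-σmin * ((j : ℝ) / δ))) :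
    |(∑' j : ℕ, Real.exp (-((T : ℝ) / c) * atomReg L β c δ j)) - levelMoment L β T| ≤
      (∑' j : ℕ, min (xval L β j ^ 2) (S * δ * j)) + (∑' j : ℕ, if j = 0 then (0 : ℝ) else Real.exp (-σmin * ((j : ℝ) / δ))) := by
  have hβ0 : 0 < β := by linarith
  have hσ : 0 < (T : ℝ) / c := lt_of_lt_of_le hσmin hlow
  have hu : Summable fun j : ℕ => Real.exp (-((T : ℝ) / c) * atomReg L β c δ j) := summable_exp_atomReg hβ0 hδ hδ1 hσ
  have hv : Summable fun j : ℕ => xval L β j ^ T := (hasSum_xval_pow hTF hβ hT).summable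
  have hm : levelMoment L β T = ∑' j : ℕ, xval L β j ^ T := rfl
  rw [hm, ← hu.tsum_sub hv, ← hs1.tsum_add hs2]
  have habs : Summable fun j : ℕ => |Real.exp (-((T : ℝ) / c) * atomReg L β c δ j) - xval L β j ^ T| := (hu.sub hv).abs
  have h1 : |∑' j : ℕ, (Real.exp (-((T : ℝ) / c) * atomReg L β c δ j) - xval L β j ^ T)| ≤
      ∑' j : ℕ, |Real.exp (-((T : ℝ) / c) * atomReg L β c δ j) - xval L β j ^ T| := by
    have hs : Summable fun j : ℕ => ‖Real.exp (-((T : ℝ) / c) * atomReg L β c δ j) - xval L β j ^ T‖ := by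
      simpa only [Real.norm_eq_abs] using habs
    have := norm_tsum_le_tsum_norm hs
    simpa only [Real.norm_eq_abs] using this
  refine h1.trans (Summable.tsum_le_tsum (fun j => ?_) habs (hs1.add hs2))
  refine (abs_exp_atomReg_sub_le hβ0 hc hδ hδ1 T j).trans (add_le_add ?_ ?_)
  · apply min_le_min (xval_pow_le_sq hβ0 j hT)
    have hj : (0 : ℝ) ≤ j := Nat.cast_nonneg j
    have : (T : ℝ) / c * δ ≤ S * δ := mul_le_mul_of_nonneg_right hup hδ.le
    exact mul_le_mul_of_nonneg_right this hj
  · split_ifs with hj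
    · exact le_rfl
    · apply Real.exp_le_exp.mpr
      have hjδ : (0 : ℝ) ≤ (j : ℝ) / δ := by positivity
      nlinarith

end Summit.QuantumFields.YangMills.Theorems.FemtoTransferGap.TraceDoor

end
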